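/-
Copyright (c) 2026. All rights reserved.
Released under Apache 2.0 license as described in the file LICENSE.
Authors: HodgeCM publication cell (pub-hodgecm), GR lane, seat GR-2 (`pub-hodgecm-own-hyp34`).
-/
import Literature.NumberTheory.GelbartRogawski1991.DoubledWeilRepresentationArchHalf3
import Literature.NumberTheory.Weil1964.ArchUnitaryWeilHalf3Sign
import Literature.NumberTheory.Weil1964.ArchFrame3Scaling
import HarnessLib

/-!
# The doubling element `δ` commutes with the sign elements: the origin value `+1` of the archimedean half at the
# `F_v`-rational sign elements of the Siegel parabolic (type-(ii) places)

Sequel of `DoubledWeilRepresentationArchHalf3` (three-block archimedean section `archWeilSection3D` of the doubled unitary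
group over a general quadratic `E/F`) and `Weil1964/ArchUnitaryWeilHalf3Sign` (at a sign element `q` of the split real
places the section IS the sign Levi operator `leviGL ã`, origin value `+1`, invariant under lifts of the centraliser of
`m(ã)`).  The parabolic prescription of [GelbartRogawski1991, Prop. 3.1.1] reads origin values after conjugation by
Weil's `r_F^𝔻(δ)`; so one needs that (a lift `z` of) the archimedean phase map of `δ` commutes with `m(ã)`.  For the
`P_Δ`-type sign patterns (`ε_{v,i} = ε_{v,n+i}`: the sign acts on an `E`-line of `Δ` and its partner) this holds because
`δ` only mixes the coordinates `i`, `n+i` and their duals, and the Gram data are diagonal: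

* §1 (adelic) `ratSp_deltaD_apply_mul`: `δ_𝔸 (u·x, u·y) = u · δ_𝔸 (x, y)` for `u : Fin (n+n) → 𝔸_F` with `u_i = u_{n+i}`;
* §2 (archimedean) `archAct_ratSp_deltaD_mul`: the same for `archAct` and `r : Fin (n+n) → F ⊗ ℝ` with `r_i = r_{n+i}`;
* (frame, `Weil1964/ArchFrame3Scaling.archFolland_frame3_mul`): the Folland coordinates `Ξ` of `frame3` turn the coordinatewise
  scaling by a real-place pattern `r` (`(r_j)_v ∈ ℝ` at real `v`, `1` at complex `v`) into the diagonal scaling `ã` of `ℝ^{FrameIdx}`;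
* §4 **`archPhaseMap_ratSp_deltaD_mul`** / **`proj_leviGL_mul_proj_eq_of_over_deltaD`**: the archimedean phase map of `δ` in
  `frame3D` commutes with `m(ã)`, hence `proj (leviGL ã) · proj z = proj z · proj (leviGL ã)` for every `z ∈ Mp^𝓢` over it;
* §5 **`conj_archWeilSection3D_apply_zero_of_sign`** — THE `hone` INPUT of `DoubledWeilRepresentationArchLiftSigns`: for a
  sign element `q` of the split real places with a `P_Δ`-type pattern and any such `z`,
  `(z · archWeilSection3D x₂ x₃ q · z⁻¹ · f)(0) = f(0)`.

Topic `NumberTheory/GelbartRogawski1991`; namespace `…GRConstructionGen`.  KERNEL only: theorems; no definition, no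
`def … : Prop`, no named fact, no `sorry`.  Written for the stage-1 cell `pub-hodgecm` (GR lane); nothing here is a claim of
the manuscripts adjudicated by that cell; `HC_CM` is not touched.

## References
* S. Gelbart, J. Rogawski, Invent. Math. 105 (1991), §3.1 Prop. 3.1.1 p. 455 [GelbartRogawski1991].
* S. S. Kudla, Israel J. Math. 87 (1994), §3 (3.5) [Kudla1994].
* G. B. Folland, *Harmonic Analysis in Phase Space* (1989), §4.2 (4.23)–(4.24) [Folland1989].
-/

set_option autoImplicit false

noncomputable section

open scoped Classical
open scoped Matrix Kronecker TensorProduct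
open NumberField NumberField.InfinitePlace IsDedekindDomain
open Literature.RepresentationTheory.HeisenbergGroup
open Literature.RepresentationTheory.HeisenbergGroup.SymplecticMatrix
open Literature.NumberTheory.Automorphic Literature.NumberTheory.Automorphic.UnitaryGroup
open Literature.NumberTheory.Weil1964
open Literature.NumberTheory.GaloisRepresentations
open Literature.Analysis.SegalBargmann

namespace Literature.NumberTheory.GelbartRogawski1991.GRConstructionGen

open UnitaryDualPair

/-! ## §0 Matrix lemmas -/

section Matrix

/-- a matrix whose non-zero entries only join indices with equal weights commutes with the weight scaling:
`M (U · V) = U · (M V)`. [cite: Kudla1994, §3] -/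
theorem mulVec_mul_of_apply_ne_zero {K m : Type*} [CommRing K] [Fintype m] (M : Matrix m m K) (U V : m → K)
    (h : ∀ k l, M k l ≠ 0 → U k = U l) : M *ᵥ (U * V) = U * (M *ᵥ V) := by
  funext k
  simp only [Matrix.mulVec, dotProduct, Pi.mul_apply, Finset.mul_sum]
  refine Finset.sum_congr rfl fun l _ => ?_
  by_cases hkl : M k l = 0
  · rw [hkl, zero_mul, zero_mul, mul_zero]
  · rw [h k l hkl]; ring

/-- the entries of the doubling matrix `δ` vanish unless the two indices have the same inner coordinate.
[cite: Kudla1994, §3] -/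
theorem deltaDiagMatrix_apply_eq_zero {K ι : Type*} [CommRing K] [DecidableEq ι] (a b : (ι ⊕ ι) ⊕ (ι ⊕ ι))
    (h : Sum.elim (Sum.elim id id) (Sum.elim id id) a ≠ Sum.elim (Sum.elim id id) (Sum.elim id id) b) :
    deltaDiagMatrix K ι a b = 0 := by
  rcases a with (i | i) | (i | i) <;> rcases b with (j | j) | (j | j) <;>
    simp_all [deltaDiagMatrix, Matrix.fromBlocks, Matrix.neg_apply]

end Matrix

variable (F : Type) [Field F] [NumberField F] (E : Type) [Field E] [NumberField E] [Algebra F E]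
  [Algebra.IsQuadraticExtension F E]
variable (c : E ≃ₐ[F] E) {δ : E} (hcδ : c δ = -δ) (hδ : δ ≠ 0) {d : F} (hd : δ * δ = algebraMap F E d)
variable {N M n : ℕ} (e : Fin N × Fin M ≃ Fin n)
  (dV : Fin N → F) (hV : (Matrix.diagonal dV).IsSymm) (hVd : IsUnit (Matrix.diagonal dV).det) (hdV0 : ∀ i, dV i ≠ 0)
  (dW : Fin M → F) (hW : (Matrix.diagonal dW).IsSymm) (hWd : IsUnit (Matrix.diagonal dW).det) (hdW0 : ∀ j, dW j ≠ 0)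

/-! ## §1 `δ_𝔸` commutes with the `P_Δ`-type weight scalings -/

section Adelic

omit [NumberField E] [Algebra.IsQuadraticExtension F E] in
/-- `T^𝔻 ⊗ 1 = diag(t₀^𝔻) ⊗ 1`. [cite: HarrisKudlaSweet1996, §1 (1.9)] -/
theorem gramDA_eq_diagonal :
    gramDA F e (Matrix.diagonal dV) (Matrix.diagonal dW) =
      Matrix.diagonal fun j => algebraMap F (AdeleRing (𝓞 F) F) (t₀D F e dV dW j) := by
  unfold gramDA
  rw [gramD_eq_diagonal_gen, Matrix.diagonal_map (map_zero _)]

include hVd hWd in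
/-- **`δ_𝔸 (u·x, u·y) = u · δ_𝔸 (x, y)`** for a weight `u : Fin (n+n) → 𝔸_F` with `u_i = u_{n+i}` (`δ` only mixes `i` with
`n+i`; the Gram data are diagonal). [cite: Kudla1994, §3] -/
theorem ratSp_deltaD_apply_mul (u : Fin (n + n) → AdeleRing (𝓞 F) F)
    (hu : ∀ i : Fin n, u (e₂ (n := n) (Sum.inl i)) = u (e₂ (n := n) (Sum.inr i))) (x y : Fin (n + n) → AdeleRing (𝓞 F) F) :
    ((ratSp F (gramDA F e (Matrix.diagonal dV) (Matrix.diagonal dW))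
        (isUnit_det_gramDA F e _ hVd _ hWd) (deltaD F)).1 : _ ≃ₗ[AdeleRing (𝓞 F) F] _) (u * x, u * y) =
      (u * (((ratSp F (gramDA F e (Matrix.diagonal dV) (Matrix.diagonal dW))
          (isUnit_det_gramDA F e _ hVd _ hWd) (deltaD F)).1 : _ ≃ₗ[AdeleRing (𝓞 F) F] _) (x, y)).1,
       u * (((ratSp F (gramDA F e (Matrix.diagonal dV) (Matrix.diagonal dW))
          (isUnit_det_gramDA F e _ hVd _ hWd) (deltaD F)).1 : _ ≃ₗ[AdeleRing (𝓞 F) F] _) (x, y)).2) := by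
  set T := gramDA F e (Matrix.diagonal dV) (Matrix.diagonal dW) with hT
  have hTu := isUnit_det_gramDA F e _ hVd _ hWd
  have hTdiag := gramDA_eq_diagonal F e dV dW
  -- the weight on `Fin (n+n) ⊕ Fin (n+n)` and its compatibility with `δ`
  set U : Fin (n + n) ⊕ Fin (n + n) → AdeleRing (𝓞 F) F := Sum.elim u u with hU
  have hMδ : ∀ V : Fin (n + n) ⊕ Fin (n + n) → AdeleRing (𝓞 F) F,
      ((mapHom (algebraMap F (AdeleRing (𝓞 F) F)) (deltaD F) : Matrix.symplecticGroup (Fin (n + n)) _) :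
        Matrix (Fin (n + n) ⊕ Fin (n + n)) (Fin (n + n) ⊕ Fin (n + n)) (AdeleRing (𝓞 F) F)) *ᵥ (U * V) =
      U * (((mapHom (algebraMap F (AdeleRing (𝓞 F) F)) (deltaD F) : Matrix.symplecticGroup (Fin (n + n)) _) :
        Matrix (Fin (n + n) ⊕ Fin (n + n)) (Fin (n + n) ⊕ Fin (n + n)) (AdeleRing (𝓞 F) F)) *ᵥ V) := by
    intro V
    refine mulVec_mul_of_apply_ne_zero _ U V fun k l hkl => ?_
    rw [coe_mapHom_deltaD, Matrix.reindex_apply, Matrix.submatrix_apply] at hkl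
    have hinner : Sum.elim (Sum.elim id id) (Sum.elim id id) (((e₂ (n := n)).sumCongr (e₂ (n := n))).symm k) =
        Sum.elim (Sum.elim id id) (Sum.elim id id) (((e₂ (n := n)).sumCongr (e₂ (n := n))).symm l) := by
      by_contra hne
      exact hkl (deltaDiagMatrix_apply_eq_zero _ _ hne)
    -- `U` is a function of the inner coordinate
    have hUk : ∀ k : Fin (n + n) ⊕ Fin (n + n), U k =
        u (e₂ (n := n) (Sum.inl (Sum.elim (Sum.elim id id) (Sum.elim id id) (((e₂ (n := n)).sumCongr (e₂ (n := n))).symm k)))) := by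
      intro k
      rcases k with k | k
      · obtain ⟨s, rfl⟩ := (e₂ (n := n)).surjective k
        rw [hU, Sum.elim_inl, Equiv.sumCongr_symm, Equiv.sumCongr_apply, Sum.map_inl, Equiv.symm_apply_apply, Sum.elim_inl]
        rcases s with i | i
        · rfl
        · exact (hu i).symm
      · obtain ⟨s, rfl⟩ := (e₂ (n := n)).surjective k
        rw [hU, Sum.elim_inr, Equiv.sumCongr_symm, Equiv.sumCongr_apply, Sum.map_inr, Equiv.symm_apply_apply, Sum.elim_inr]
        rcases s with i | i
        · rfl
        · exact (hu i).symm
    rw [hUk k, hUk l, hinner]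
  have key : ∀ v : (Fin (n + n) → AdeleRing (𝓞 F) F) × (Fin (n + n) → AdeleRing (𝓞 F) F),
      ((ratSp F T hTu (deltaD F)).1 : _ ≃ₗ[AdeleRing (𝓞 F) F] _) v =
        (SymplecticMatrix.darboux T hTu).symm (((mapHom (algebraMap F (AdeleRing (𝓞 F) F)) (deltaD F) : Matrix.symplecticGroup (Fin (n + n)) _) :
          Matrix (Fin (n + n) ⊕ Fin (n + n)) (Fin (n + n) ⊕ Fin (n + n)) (AdeleRing (𝓞 F) F)) *ᵥ SymplecticMatrix.darboux T hTu v) :=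
    fun v => coe_transportSp_apply T hTu _ v
  rw [key, key, SymplecticMatrix.darboux_apply, SymplecticMatrix.darboux_apply]
  dsimp only
  have h1 : Sum.elim (u * x) (T *ᵥ (u * y)) = U * Sum.elim x (T *ᵥ y) := by
    rw [hT, hTdiag, diagonal_mulVec_mul]
    funext k; rcases k with k | k <;> rfl
  rw [h1, hMδ, SymplecticMatrix.darboux_symm_apply, SymplecticMatrix.darboux_symm_apply]
  set W := ((mapHom (algebraMap F (AdeleRing (𝓞 F) F)) (deltaD F) : Matrix.symplecticGroup (Fin (n + n)) _) :
    Matrix (Fin (n + n) ⊕ Fin (n + n)) (Fin (n + n) ⊕ Fin (n + n)) (AdeleRing (𝓞 F) F)) *ᵥ Sum.elim x (T *ᵥ y) with hW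
  refine Prod.ext rfl ?_
  show T⁻¹ *ᵥ ((U * W) ∘ Sum.inr) = u * (T⁻¹ *ᵥ (W ∘ Sum.inr))
  rw [show (U * W) ∘ Sum.inr = u * (W ∘ Sum.inr) from rfl, hT, hTdiag, Matrix.inv_diagonal, diagonal_mulVec_mul]

end Adelic

/-! ## §2 The archimedean action of `δ` commutes with the `P_Δ`-type weight scalings -/

section Arch

omit [NumberField E] [Algebra F E] [Algebra.IsQuadraticExtension F E] in
/-- `archVec (r · a) = archVec r · archVec a` (the archimedean embedding is multiplicative coordinatewise).
[cite: CasselsFrohlichANT1967, Ch. II §14] -/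
theorem archVec_mul {ι : Type} [Fintype ι] (r a : ι → mixedEmbedding.mixedSpace F) :
    archVec F ι (r * a) = archVec F ι r * archVec F ι a := by
  funext i
  refine Prod.ext ?_ ?_
  · change (InfiniteAdeleRing.ringEquiv_mixedSpace F).symm ((r * a) i) = (archVec F ι r i).1 * (archVec F ι a i).1
    rw [archVec_apply_fst, archVec_apply_fst, Pi.mul_apply, map_mul]
  · change (0 : FiniteAdeleRing (𝓞 F) F) = (archVec F ι r i).2 * (archVec F ι a i).2
    rw [archVec_apply_snd, archVec_apply_snd, mul_zero]

omit [NumberField E] [Algebra F E] [Algebra.IsQuadraticExtension F E] in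
/-- `piArch (archVec r · Z) = r · piArch Z`. [cite: CasselsFrohlichANT1967, Ch. II §14] -/
theorem piArch_archVec_mul {ι : Type} [Fintype ι] (r : ι → mixedEmbedding.mixedSpace F) (Z : ι → AdeleRing (𝓞 F) F) :
    piArch F ι (archVec F ι r * Z) = r * piArch F ι Z := by
  funext i
  rw [piArch_apply, Pi.mul_apply, Pi.mul_apply, piArch_apply]
  change InfiniteAdeleRing.ringEquiv_mixedSpace F ((archVec F ι r i).1 * (Z i).1) = _
  rw [map_mul, archVec_apply_fst, RingEquiv.apply_symm_apply]

include hVd hWd in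
/-- **`archAct δ (r·a, r·w) = r · archAct δ (a, w)`** for a weight `r : Fin (n+n) → F ⊗ ℝ` with `r_i = r_{n+i}`.
[cite: Kudla1994, §3] -/
theorem archAct_ratSp_deltaD_mul (r : Fin (n + n) → mixedEmbedding.mixedSpace F)
    (hr : ∀ i : Fin n, r (e₂ (n := n) (Sum.inl i)) = r (e₂ (n := n) (Sum.inr i)))
    (a w : Fin (n + n) → mixedEmbedding.mixedSpace F) :
    archAct (gramDA F e (Matrix.diagonal dV) (Matrix.diagonal dW))
        (ratSp F (gramDA F e (Matrix.diagonal dV) (Matrix.diagonal dW)) (isUnit_det_gramDA F e _ hVd _ hWd) (deltaD F))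
        (r * a, r * w) =
      (r * (archAct (gramDA F e (Matrix.diagonal dV) (Matrix.diagonal dW))
          (ratSp F (gramDA F e (Matrix.diagonal dV) (Matrix.diagonal dW)) (isUnit_det_gramDA F e _ hVd _ hWd) (deltaD F))
          (a, w)).1,
       r * (archAct (gramDA F e (Matrix.diagonal dV) (Matrix.diagonal dW))
          (ratSp F (gramDA F e (Matrix.diagonal dV) (Matrix.diagonal dW)) (isUnit_det_gramDA F e _ hVd _ hWd) (deltaD F))
          (a, w)).2) := by
  unfold archAct
  simp only [archVec_mul]
  rw [ratSp_deltaD_apply_mul F e dV hVd dW hWd (archVec F (Fin (n + n)) r)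
    (fun i => by rw [← Prod.eta (archVec F (Fin (n + n)) r (e₂ (Sum.inl i))), archVec_apply_fst, archVec_apply_snd, hr i]; rfl)]
  simp only [piArch_archVec_mul]

end Arch

/-! ## §4 The archimedean phase map of `δ` commutes with the sign Levis of `P_Δ`-type -/

section PhaseMap

variable (εR : {v : {v : InfinitePlace F // v.IsReal} // ¬ IsTypeOne F E v} → Fin (n + n) → ℝ)
  (hsym : ∀ k (i : Fin n), εR k (e₂ (n := n) (Sum.inl i)) = εR k (e₂ (n := n) (Sum.inr i)))

include hVd hWd hsym in
/-- **`archPhaseMap δ (ã p, ã q) = ã · archPhaseMap δ (p, q)`** in the frame `frame3D`, for the frame diagonal `ã` of a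
`P_Δ`-type real-place pattern (`ε_{v,i} = ε_{v,n+i}` at the type-(ii) places, `1` elsewhere). [cite: Kudla1994, §3 (3.5)] -/
theorem archPhaseMap_ratSp_deltaD_mul (pq : (FrameIdx F (Fin (n + n)) → ℝ) × (FrameIdx F (Fin (n + n)) → ℝ)) :
    archPhaseMap (gramDA F e (Matrix.diagonal dV) (Matrix.diagonal dW)) (frame3D F E c hcδ hδ e dV hdV0 dW hdW0)
        (isUnit_archMat_gramDA F e _ hVd _ hWd)
        (ratSp F (gramDA F e (Matrix.diagonal dV) (Matrix.diagonal dW)) (isUnit_det_gramDA F e _ hVd _ hWd) (deltaD F))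
        (Sum.elim (fun jv : Fin (n + n) × {v : InfinitePlace F // v.IsReal} =>
            if h : IsTypeOne F E jv.2 then (1 : ℝ) else εR ⟨jv.2, h⟩ jv.1) (fun _ => (1 : ℝ)) * pq.1,
         Sum.elim (fun jv : Fin (n + n) × {v : InfinitePlace F // v.IsReal} =>
            if h : IsTypeOne F E jv.2 then (1 : ℝ) else εR ⟨jv.2, h⟩ jv.1) (fun _ => (1 : ℝ)) * pq.2) =
      (Sum.elim (fun jv : Fin (n + n) × {v : InfinitePlace F // v.IsReal} =>
            if h : IsTypeOne F E jv.2 then (1 : ℝ) else εR ⟨jv.2, h⟩ jv.1) (fun _ => (1 : ℝ)) *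
          (archPhaseMap (gramDA F e (Matrix.diagonal dV) (Matrix.diagonal dW)) (frame3D F E c hcδ hδ e dV hdV0 dW hdW0)
            (isUnit_archMat_gramDA F e _ hVd _ hWd)
            (ratSp F (gramDA F e (Matrix.diagonal dV) (Matrix.diagonal dW)) (isUnit_det_gramDA F e _ hVd _ hWd) (deltaD F))
            pq).1,
       Sum.elim (fun jv : Fin (n + n) × {v : InfinitePlace F // v.IsReal} =>
            if h : IsTypeOne F E jv.2 then (1 : ℝ) else εR ⟨jv.2, h⟩ jv.1) (fun _ => (1 : ℝ)) *
          (archPhaseMap (gramDA F e (Matrix.diagonal dV) (Matrix.diagonal dW)) (frame3D F E c hcδ hδ e dV hdV0 dW hdW0)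
            (isUnit_archMat_gramDA F e _ hVd _ hWd)
            (ratSp F (gramDA F e (Matrix.diagonal dV) (Matrix.diagonal dW)) (isUnit_det_gramDA F e _ hVd _ hWd) (deltaD F))
            pq).2) := by
  -- the real-place weight `ρ_v = ε_v` at type (ii), `1` at type (i)
  set ρ : {v : InfinitePlace F // v.IsReal} → Fin (n + n) → ℝ := fun v j => if h : IsTypeOne F E v then (1 : ℝ) else εR ⟨v, h⟩ j
    with hρ
  have hρe : (Sum.elim (fun jv : Fin (n + n) × {v : InfinitePlace F // v.IsReal} =>
      if h : IsTypeOne F E jv.2 then (1 : ℝ) else εR ⟨jv.2, h⟩ jv.1) (fun _ => (1 : ℝ)) : FrameIdx F (Fin (n + n)) → ℝ) =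
      Sum.elim (fun jv : Fin (n + n) × {v : InfinitePlace F // v.IsReal} => ρ jv.2 jv.1) (fun _ => (1 : ℝ)) := rfl
  have hr : ∀ i : Fin n, (fun j => ((fun v => ρ v j, fun _ => (1 : ℂ)) : mixedEmbedding.mixedSpace F)) (e₂ (n := n) (Sum.inl i)) =
      (fun j => ((fun v => ρ v j, fun _ => (1 : ℂ)) : mixedEmbedding.mixedSpace F)) (e₂ (n := n) (Sum.inr i)) := by
    intro i
    refine Prod.ext (funext fun v => ?_) rfl
    change ρ v _ = ρ v _
    simp only [hρ]
    split_ifs with h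
    · rfl
    · exact hsym ⟨v, h⟩ i
  have hTarch : archMat F (Fin (n + n)) (gramDA F e (Matrix.diagonal dV) (Matrix.diagonal dW)) =
      Matrix.diagonal fun j => archMat F (Fin (n + n)) (gramDA F e (Matrix.diagonal dV) (Matrix.diagonal dW)) j j := by
    have h := archMat_diagonal_map (F' := F) (n + n) (t₀D F e dV dW)
    unfold gramDA at h ⊢
    rw [gramD_eq_diagonal_gen]
    exact h
  rw [hρe]
  obtain ⟨⟨a, w⟩, rfl⟩ := (archFolland_bijective (T := gramDA F e (Matrix.diagonal dV) (Matrix.diagonal dW))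
    (frame3D F E c hcδ hδ e dV hdV0 dW hdW0) (isUnit_archMat_gramDA F e _ hVd _ hWd)).2 pq
  have hFE := archFolland_frame3_mul E c (n + n) (LocalSplitting.galConj_ne_one_of_delta F E c hcδ hδ) (IsTypeOne F E)
    (placeAboveOne F E) (smul_placeAboveOne F E c) (placeAboveComplex F E) (placeAboveComplex_comap F E) (t₀D F e dV dW)
    (t₀D_ne_zero F e dV hdV0 dW hdW0) hcδ hδ ρ (gramDA F e (Matrix.diagonal dV) (Matrix.diagonal dW)) _ hTarch
  rw [archPhaseMap_archFolland]
  rw [show ((Sum.elim (fun jv : Fin (n + n) × {v : InfinitePlace F // v.IsReal} => ρ jv.2 jv.1) (fun _ => (1 : ℝ)) *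
        (archFolland (gramDA F e (Matrix.diagonal dV) (Matrix.diagonal dW))
          (frame3D F E c hcδ hδ e dV hdV0 dW hdW0) (a, w)).1,
      Sum.elim (fun jv : Fin (n + n) × {v : InfinitePlace F // v.IsReal} => ρ jv.2 jv.1) (fun _ => (1 : ℝ)) *
        (archFolland (gramDA F e (Matrix.diagonal dV) (Matrix.diagonal dW))
          (frame3D F E c hcδ hδ e dV hdV0 dW hdW0) (a, w)).2) : (FrameIdx F (Fin (n + n)) → ℝ) × (FrameIdx F (Fin (n + n)) → ℝ)) =
      archFolland _ (frame3D F E c hcδ hδ e dV hdV0 dW hdW0) (_ * a, _ * w) from (hFE a w).symm,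
    archPhaseMap_archFolland, archAct_ratSp_deltaD_mul F e dV hVd dW hWd _ hr a w]
  exact hFE _ _

include hVd hWd hsym in
/-- **`proj (leviGL ã) · proj z = proj z · proj (leviGL ã)`** for every `z ∈ Mp^𝓢(ℝ^{FrameIdx})` over the archimedean phase map of
`δ` in `frame3D` and the frame sign diagonal `ã` of a `P_Δ`-type pattern. [cite: Kudla1994, §3 (3.5); Folland1989, §4.2 (4.24)] -/
theorem proj_leviGL_mul_proj_eq_of_over_deltaD (hεR : ∀ k j, εR k j = 1 ∨ εR k j = -1)
    (ã : GL (FrameIdx F (Fin (n + n))) ℝ)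
    (hã : (ã : Matrix (FrameIdx F (Fin (n + n))) (FrameIdx F (Fin (n + n))) ℝ) = Matrix.diagonal
      (Sum.elim (fun jv : Fin (n + n) × {v : InfinitePlace F // v.IsReal} =>
        if h : IsTypeOne F E jv.2 then (1 : ℝ) else εR ⟨jv.2, h⟩ jv.1) (fun _ => (1 : ℝ))))
    (z : MpS (FrameIdx F (Fin (n + n))))
    (hz' : (⇑((MpS.proj z).1 : ((FrameIdx F (Fin (n + n)) → ℝ) × (FrameIdx F (Fin (n + n)) → ℝ)) ≃ₗ[ℝ]
        ((FrameIdx F (Fin (n + n)) → ℝ) × (FrameIdx F (Fin (n + n)) → ℝ))) :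
        ((FrameIdx F (Fin (n + n)) → ℝ) × (FrameIdx F (Fin (n + n)) → ℝ)) →
          ((FrameIdx F (Fin (n + n)) → ℝ) × (FrameIdx F (Fin (n + n)) → ℝ))) =
      archPhaseMap (gramDA F e (Matrix.diagonal dV) (Matrix.diagonal dW)) (frame3D F E c hcδ hδ e dV hdV0 dW hdW0)
        (isUnit_archMat_gramDA F e _ hVd _ hWd)
        (ratSp F (gramDA F e (Matrix.diagonal dV) (Matrix.diagonal dW)) (isUnit_det_gramDA F e _ hVd _ hWd) (deltaD F))) :
    MpS.proj (MpS.leviGL ã) * MpS.proj z = MpS.proj z * MpS.proj (MpS.leviGL ã) := by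
  have hdiag : ∀ v : FrameIdx F (Fin (n + n)) → ℝ,
      Matrix.diagonal (Sum.elim (fun jv : Fin (n + n) × {v : InfinitePlace F // v.IsReal} =>
        if h : IsTypeOne F E jv.2 then (1 : ℝ) else εR ⟨jv.2, h⟩ jv.1) (fun _ => (1 : ℝ))) *ᵥ v =
      Sum.elim (fun jv : Fin (n + n) × {v : InfinitePlace F // v.IsReal} =>
        if h : IsTypeOne F E jv.2 then (1 : ℝ) else εR ⟨jv.2, h⟩ jv.1) (fun _ => (1 : ℝ)) * v :=
    fun v => funext fun k => Matrix.mulVec_diagonal _ _ k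
  have hz1 : ∀ PQ : (FrameIdx F (Fin (n + n)) → ℝ) × (FrameIdx F (Fin (n + n)) → ℝ),
      ((MpS.proj z).1 : ((FrameIdx F (Fin (n + n)) → ℝ) × (FrameIdx F (Fin (n + n)) → ℝ)) ≃ₗ[ℝ]
        ((FrameIdx F (Fin (n + n)) → ℝ) × (FrameIdx F (Fin (n + n)) → ℝ))) PQ =
      archPhaseMap (gramDA F e (Matrix.diagonal dV) (Matrix.diagonal dW)) (frame3D F E c hcδ hδ e dV hdV0 dW hdW0)
        (isUnit_archMat_gramDA F e _ hVd _ hWd)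
        (ratSp F (gramDA F e (Matrix.diagonal dV) (Matrix.diagonal dW)) (isUnit_det_gramDA F e _ hVd _ hWd) (deltaD F)) PQ :=
    fun PQ => congrFun hz' PQ
  apply Subtype.ext
  apply LinearEquiv.ext
  intro pq
  rw [Subgroup.coe_mul, Subgroup.coe_mul, LinearEquiv.mul_apply, LinearEquiv.mul_apply]
  have h1 := MpS.coe_proj_leviGL_apply_of_eq_diagonal_sign _ (sign3_cases (n + n) (IsTypeOne F E) εR hεR) ã hã
    (archPhaseMap (gramDA F e (Matrix.diagonal dV) (Matrix.diagonal dW)) (frame3D F E c hcδ hδ e dV hdV0 dW hdW0)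
        (isUnit_archMat_gramDA F e _ hVd _ hWd)
        (ratSp F (gramDA F e (Matrix.diagonal dV) (Matrix.diagonal dW)) (isUnit_det_gramDA F e _ hVd _ hWd) (deltaD F)) pq)
  have h2 := MpS.coe_proj_leviGL_apply_of_eq_diagonal_sign _ (sign3_cases (n + n) (IsTypeOne F E) εR hεR) ã hã pq
  rw [hdiag] at h1
  rw [hdiag] at h1
  rw [hdiag] at h2
  rw [hdiag] at h2
  refine (congrArg (fun v => ((MpS.proj (MpS.leviGL ã)).1 : ((FrameIdx F (Fin (n + n)) → ℝ) × (FrameIdx F (Fin (n + n)) → ℝ)) ≃ₗ[ℝ]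
    ((FrameIdx F (Fin (n + n)) → ℝ) × (FrameIdx F (Fin (n + n)) → ℝ))) v) (hz1 pq)).trans ?_
  refine h1.trans ?_
  refine (archPhaseMap_ratSp_deltaD_mul F E c hcδ hδ e dV hVd hdV0 dW hWd hdW0 εR hsym pq).symm.trans ?_
  refine (hz1 _).symm.trans ?_
  exact congrArg _ h2.symm

end PhaseMap

/-! ## §5 The origin value `+1` after conjugation by a lift of `δ`: the `hone` input -/

section Hone

variable (x₂ : MpS (Fin (n + n) × {v : {v : InfinitePlace F // v.IsReal} // ¬ IsTypeOne F E v}))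
  (hx₂ : MpS.proj x₂ = placeSp fun k => (rsCayley3D F E e dV hdV0 dW hdW0 (hδ := hδ) k)⁻¹)
  (x₃ : MpS ((Fin (n + n) ⊕ Fin (n + n)) × {v : InfinitePlace F // v.IsComplex}))
  (q : UnitaryGroup.arch F E c (n + n) (hermD F E e (Matrix.diagonal dV) (Matrix.diagonal dW)))
  (hC : ∀ w : {w : InfinitePlace E // w.IsComplex},
    (((q : GL (Fin (n + n)) (mixedEmbedding.mixedSpace E)) : Matrix (Fin (n + n)) (Fin (n + n)) (mixedEmbedding.mixedSpace E))).map
      (evalC E w) = 1)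
  (εR : {v : {v : InfinitePlace F // v.IsReal} // ¬ IsTypeOne F E v} → Fin (n + n) → ℝ) (hεR : ∀ k j, εR k j = 1 ∨ εR k j = -1)
  (hsym : ∀ k (i : Fin n), εR k (e₂ (n := n) (Sum.inl i)) = εR k (e₂ (n := n) (Sum.inr i)))
  (hR : ∀ k : {v : {v : InfinitePlace F // v.IsReal} // ¬ IsTypeOne F E v},
    (((q : GL (Fin (n + n)) (mixedEmbedding.mixedSpace E)) : Matrix (Fin (n + n)) (Fin (n + n)) (mixedEmbedding.mixedSpace E))).map
      (evalR E (placeAboveTwo F E k)) = Matrix.diagonal (εR k))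

include hVd hWd hx₂ hC hεR hsym hR in
/-- **THE ORIGIN VALUE `+1` AT THE `F_v`-RATIONAL SIGN ELEMENTS** (the `hone` input of `DoubledWeilRepresentationArchLiftSigns`):
for a sign element `q` of the split real places with a `P_Δ`-type pattern (`ε_{v,i} = ε_{v,n+i}`, complex components `1`)
and ANY `z ∈ Mp^𝓢` over the archimedean phase map of `δ` in `frame3D`,
`(z · archWeilSection3D x₂ x₃ q · z⁻¹ · f)(0) = f(0)` for every Schwartz `f`.
[cite: GelbartRogawski1991, §3.1 Prop. 3.1.1 p. 455; Kudla1994, §3 (3.5); Folland1989, §4.2 (4.24)] -/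
theorem conj_archWeilSection3D_apply_zero_of_sign (z : MpS (FrameIdx F (Fin (n + n))))
    (hz' : (⇑((MpS.proj z).1 : ((FrameIdx F (Fin (n + n)) → ℝ) × (FrameIdx F (Fin (n + n)) → ℝ)) ≃ₗ[ℝ]
        ((FrameIdx F (Fin (n + n)) → ℝ) × (FrameIdx F (Fin (n + n)) → ℝ))) :
        ((FrameIdx F (Fin (n + n)) → ℝ) × (FrameIdx F (Fin (n + n)) → ℝ)) →
          ((FrameIdx F (Fin (n + n)) → ℝ) × (FrameIdx F (Fin (n + n)) → ℝ))) =
      archPhaseMap (gramDA F e (Matrix.diagonal dV) (Matrix.diagonal dW)) (frame3D F E c hcδ hδ e dV hdV0 dW hdW0)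
        (isUnit_archMat_gramDA F e _ hVd _ hWd)
        (ratSp F (gramDA F e (Matrix.diagonal dV) (Matrix.diagonal dW)) (isUnit_det_gramDA F e _ hVd _ hWd) (deltaD F)))
    (f : SchwartzMap (FrameIdx F (Fin (n + n)) → ℝ) ℂ) :
    (z * archWeilSection3D F E c hcδ hδ e dV hdV0 dW hdW0 x₂ x₃ q * z⁻¹).1.2 f 0 = f 0 := by
  obtain ⟨ã, hã⟩ := exists_signGL3 (n + n) (IsTypeOne F E) εR hεR
  have hS := archWeilSection3_eq_leviGL_of_sign E c (n + n) (LocalSplitting.galConj_ne_one_of_delta F E c hcδ hδ)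
    (AlgEquiv.ext (LocalSplitting.galConj_apply_apply F E c hcδ hδ)) (IsTypeOne F E) (placeAboveOne F E)
    (smul_placeAboveOne F E c) (placeAboveOne_comap F E) (placeAboveTwo F E) (placeAboveComplex F E) (t₀D F e dV dW)
    (t₀D_ne_zero F e dV hdV0 dW hdW0) (gramD_eq_diagonal_gen F e dV dW) rfl hcδ hδ x₂ hx₂ x₃ q hC εR hεR hR ã hã
  refine conj_archWeilSection3_apply_zero_of_sign E c (n + n) (LocalSplitting.galConj_ne_one_of_delta F E c hcδ hδ)
    (AlgEquiv.ext (LocalSplitting.galConj_apply_apply F E c hcδ hδ)) (IsTypeOne F E) (placeAboveOne F E)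
    (smul_placeAboveOne F E c) (placeAboveOne_comap F E) (placeAboveTwo F E) (placeAboveComplex F E) (t₀D F e dV dW)
    (t₀D_ne_zero F e dV hdV0 dW hdW0) (gramD_eq_diagonal_gen F e dV dW) rfl hcδ hδ x₂ hx₂ x₃ q hC εR hεR hR z ?_ f
  change MpS.proj (archWeilSection3D F E c hcδ hδ e dV hdV0 dW hdW0 x₂ x₃ q) * MpS.proj z =
    MpS.proj z * MpS.proj (archWeilSection3D F E c hcδ hδ e dV hdV0 dW hdW0 x₂ x₃ q)
  rw [show archWeilSection3D F E c hcδ hδ e dV hdV0 dW hdW0 x₂ x₃ q = MpS.leviGL ã from hS]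
  exact proj_leviGL_mul_proj_eq_of_over_deltaD F E c hcδ hδ e dV hVd hdV0 dW hWd hdW0 εR hsym hεR ã hã z hz'

end Hone



end Literature.NumberTheory.GelbartRogawski1991.GRConstructionGen

end
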